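import Mathlib
import Summits.AtomisticToContinuum.Crystallization.Theorems.GappedShellCensusFiveFoldRationingRStubFfrC5CoreLabels

/-!
# Crux `GappedShellCensus.FiveFoldRationingR` (stmt-AtomisticToContinuum-18071), line `Sketch` —
# stub `stub_ffrC5Core` (the finite core of the capped census),
# file 6/6: the registered stub `stub_ffrC5Core`

Setting (abstract fan data on the twelve labels `Fin 12`): a family `tri` of `3`-element label sets,
two per side, and a symmetric irreflexive Boolean bond relation with degrees in `{4, 5}`; every bond
is a side of exactly two members of `tri`, every bonded `3`-clique is in `tri`, every member of
`tri` has a vertex bonded to the other two, every `5`-valent label has only bonded fan triangles and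
every `4`-valent label at most two.  Conclusion: after a relabelling `σ` the bond graph is EXACTLY
the bicapped pentagonal prism (poles `0, 11`, rings `1…5` and `6…10`, verticals `k ~ k + 5`).

Proof (files 1–5): a `5`-valent label has a link pentagon of partners with no chords; no two
`5`-valent labels are adjacent (closure + double counting: `6 ∣ #D`), a `4`-valent label has at most
one `5`-valent partner, so by disjointness and handshake parity there are exactly two poles `w, w'`
whose closed neighbourhoods partition the twelve labels; the ring `u` of `w` has fourth partners `x`
forming the ring of `w'`, the quadrilateral faces give `x i ~ x (i + 1)` and parity in the pentagon
of `w'` kills `x i ~ x (i ± 2)`.  Here: `σ = (w, u 0, …, u 4, x 0, …, x 4, w')` and the `66` pairs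
are read off the bond table of `stub_ffrC5CoreLabels`.  The hypotheses `card_tri` and `link` (sphere
topology) are not needed: the local two-per-side structure and the valence pattern already force it.
-/

noncomputable section

namespace Summit.AtomisticToContinuum.Crystallization.Theorems

/-- **Sub-stub F (finite core; PROVABLE NOW — hand proof on a simplicial 2-sphere, or a generated
decidable enumeration).**  Abstract fan data: a closed triangulated surface on the twelve labels (20
triangles, two per side, connected links — hence a 2-sphere), a bond subgraph with degrees in `{4, 5}`,
some label of each degree, every fan triangle with a vertex bonded to the other two (faces T/Q), every
`5`-valent label `5T`, every `4`-valent label with `≤ 2` bonded triangles.  Then the bond graph is, after a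
relabelling, the bicapped pentagonal prism (pairs `(k, l)`, `k < l`, in the list). [folklore] -/
theorem stub_ffrC5Core (bond : Fin 12 → Fin 12 → Bool) (tri : Finset (Finset (Fin 12)))
    (bond_symm : ∀ v w, bond v w = bond w v) (bond_irrefl : ∀ v, bond v v = false)
    (bond_deg : ∀ v, 4 ≤ (Finset.univ.filter fun w => bond v w = true).card ∧
      (Finset.univ.filter fun w => bond v w = true).card ≤ 5)
    (h4ex : ∃ v, (Finset.univ.filter fun w => bond v w = true).card = 4)
    (h5ex : ∃ v, (Finset.univ.filter fun w => bond v w = true).card = 5)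
    (tri_card : ∀ S ∈ tri, S.card = 3) (card_tri : tri.card = 20)
    (two_per_side : ∀ S ∈ tri, ∀ s ⊆ S, s.card = 2 → (tri.filter fun S' => s ⊆ S').card = 2)
    (bond_side : ∀ v w, bond v w = true → (tri.filter fun S' => ({v, w} : Finset (Fin 12)) ⊆ S').card = 2)
    (bond_tri : ∀ a b c, a ≠ b → b ≠ c → a ≠ c → bond a b = true → bond b c = true → bond a c = true →
      ({a, b, c} : Finset (Fin 12)) ∈ tri)
    (link : ∀ v, ∀ A ⊆ tri.filter (fun S => v ∈ S), A.Nonempty →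
      (∀ S ∈ A, ∀ S' ∈ tri, v ∈ S' → (S ∩ S').card = 2 → S' ∈ A) → A = tri.filter fun S => v ∈ S)
    (two_bond_sides : ∀ S ∈ tri, ∃ a ∈ S, ∀ b ∈ S, b ≠ a → bond a b = true)
    (five_T : ∀ v, (Finset.univ.filter fun w => bond v w = true).card = 5 →
      ∀ S ∈ tri, v ∈ S → ∀ a ∈ S, ∀ b ∈ S, a ≠ b → bond a b = true)
    (four_T : ∀ v, (Finset.univ.filter fun w => bond v w = true).card = 4 →
      ((tri.filter fun S => v ∈ S).filter fun S => ∀ a ∈ S, ∀ b ∈ S, a ≠ b → bond a b = true).card ≤ 2) :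
    ∃ σ : Equiv.Perm (Fin 12), ∀ k l : Fin 12, k < l →
      (bond (σ k) (σ l) = true ↔ (k.val, l.val) ∈ ([(0, 1), (0, 2), (0, 3), (0, 4), (0, 5), (1, 2), (1, 5), (1, 6), (2, 3), (2, 7), (3, 4),
          (3, 8), (4, 5), (4, 9), (5, 10), (6, 7), (6, 10), (6, 11), (7, 8), (7, 11), (8, 9),
          (8, 11), (9, 10), (9, 11), (10, 11)] : List (ℕ × ℕ))) := by
  obtain ⟨w, w', u, x, hinj, hww', hwu, hwx, hw'u, hw'x, huu, hux, hxx⟩ :=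
    stub_ffrC5CoreLabels bond tri bond_symm bond_irrefl bond_deg h4ex h5ex tri_card two_per_side
      bond_side bond_tri two_bond_sides five_T four_T
  have _hct := card_tri
  have _hlk := link
  have huw' : ∀ i, bond (u i) w' = false := fun i => by rw [bond_symm]; exact hw'u i
  have hxw' : ∀ i, bond (x i) w' = true := fun i => by rw [bond_symm]; exact hw'x i
  refine ⟨Equiv.ofBijective _ hinj.bijective_of_finite, ?_⟩
  intro k l hkl
  fin_cases k <;> fin_cases l <;>
    first
    | exact absurd hkl (by decide)
    | (simp [hww', hwu, hwx, huu, hux, hxx, huw', hxw']; try decide)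

end Summit.AtomisticToContinuum.Crystallization.Theorems

end
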